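import Mathlib.Analysis.Normed.Group.Basic
import HarnessLib

/-!
# Route `UnitScaleTilt`, crux K1 «MinimiserStabilityRegPr» (stmt-QuantumFields-19200), route-R E′ path (α′), (E1-d′)∕(E1-e) seam: GAUGE ROWS FOR A MAX-OF-THREE-SUPS —
# the three displayed rows `hp_tri`, `hp_norm`, `hp_le` of `Prop7ExactCorrectorContractionGauge.exists_unique_exact_corrector_gauge`, discharged ONCE for every gauge of the shape
# `p ψ = max ‖ψ‖ (max (ℓ₁·‖T₁ ψ‖) (ℓ₂·‖T₂ ψ‖))`

Cell `ym3-torus`, width seat `ym3-torus-px13` (gen 3); offer «px13: (E1-d″) GAUGE ROWS» (bus 2026-08-28T20:57Z), sequel of ✓p667460 `…ExactCorrectorContractionGauge`.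
THEOREMS ONLY (0 `def`, 0 `sorry`, 0 `instance`); `--supports stmt-QuantumFields-19200`, count-neutral.  YM₃ on T³ is a ladder rung (R3), not the Clay problem; nothing here
claims the stub, the crux, d = 4 or the gap.  Pure normed-group bookkeeping; no lattice object appears.

WHY.  The (E1-e) knit's `X`-currency is `‖ψ‖_X := max(sup‖ψ‖, ℓ·sup‖D_Wψ‖, ℓ²·sup‖Δ_Wψ‖)` (LOCATE-E1-CONTRACTION §2).  With `X := Site → M₂` carrying its `Pi` (sup) norm,
`T₁ ψ := (b ↦ D_Wψ b)` valued in the `Pi`-normed bond-field type and `T₂ ψ := (x ↦ Δ_Wψ x)`, that currency IS `p ψ = max ‖ψ‖ (max (ℓ·‖T₁ ψ‖) (ℓ²·‖T₂ ψ‖))`, and the door's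
three gauge rows follow from two facts per `Tᵢ`: additivity `Tᵢ (a − b) = Tᵢ a − Tᵢ b` and a crude operator bound `‖Tᵢ ψ‖ ≤ aᵢ‖ψ‖` (`a₁ = 2`, `a₂ = 4d` at unitary `W`).
The gauge is passed as a bare function `p` with the displayed-definition hypothesis `hp : ∀ x, p x = max ‖x‖ (max (ℓ₁ * ‖T₁ x‖) (ℓ₂ * ‖T₂ x‖))` (the cell's `(G, hG)` currency),
so the knit instantiates by `fun _ => rfl` after `set p := …`.

WHAT IS PROVED (ns `…Theorems.Prop7GaugeRowsMaxSup`; `X`, `E₁`, `E₂` seminormed additive groups, `A`, `B` additive groups; `T₁ : X → E₁`, `T₂ : X → E₂` bare functions).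
* `map_zero_of_map_sub`, `map_add_of_map_sub`, `map_neg_of_map_sub` — additivity bookkeeping from the single row `T (a − b) = T a − T b`.
* ★ `gauge_norm_le` — `‖x‖ ≤ p x` (row `hp_norm`, no hypothesis on `Tᵢ`, `ℓᵢ`).
* ★ `gauge_nonneg`, `gauge_zero`, `gauge_neg` (evenness `p (−x) = p x`).
* ★★ `gauge_tri` — `p (a − c) ≤ p (a − b) + p (b − c)` (row `hp_tri`; needs `0 ≤ ℓᵢ` and additivity of `Tᵢ`); `gauge_add_le` — `p (a + b) ≤ p a + p b`.
* ★★ `gauge_le_mul_norm` — `p x ≤ max 1 (max (ℓ₁a₁) (ℓ₂a₂)) * ‖x‖` (row `hp_le`; needs `‖Tᵢ x‖ ≤ aᵢ‖x‖`, `0 ≤ ℓᵢ`).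
HONEST SCOPE.  Elementary; the point is that the (E1-e) knit discharges the three gauge rows of ✓p667460 by `exact` with `T₁ := D_W`, `T₂ := Δ_W`.

References: T. Bałaban, CMP 102 (1985) 277–309 [Balaban1985Variational] (Prop. 7 p.299); CMP 99 (1985) 75–102 [Balaban1985RegularSpaces] ((1.36) p.82).
-/

set_option autoImplicit false

noncomputable section

namespace Summit.QuantumFields.YangMills.Theorems.Prop7GaugeRowsMaxSup

variable {X E₁ E₂ : Type*} [SeminormedAddCommGroup X] [SeminormedAddCommGroup E₁] [SeminormedAddCommGroup E₂]

/-! ## Additivity bookkeeping from the single row `T (a − b) = T a − T b` -/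

/-- `T 0 = 0` from `T (a − b) = T a − T b`.  [cite: Balaban1985Variational, Prop. 7 p.299] -/
theorem map_zero_of_map_sub {A B : Type*} [AddCommGroup A] [AddCommGroup B] (T : A → B) (hT : ∀ a b, T (a - b) = T a - T b) :
    T 0 = 0 := by
  have h := hT 0 0
  rwa [sub_zero, sub_self] at h

/-- `T (a + b) = T a + T b` from `T (a − b) = T a − T b`.  [cite: Balaban1985Variational, Prop. 7 p.299] -/
theorem map_add_of_map_sub {A B : Type*} [AddCommGroup A] [AddCommGroup B] (T : A → B) (hT : ∀ a b, T (a - b) = T a - T b)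
    (a b : A) : T (a + b) = T a + T b := by
  have h := hT (a + b) b
  rw [add_sub_cancel_right] at h
  -- h : T a = T (a + b) - T b
  rw [h, sub_add_cancel]

/-- `T (−a) = −T a` from `T (a − b) = T a − T b`.  [cite: Balaban1985Variational, Prop. 7 p.299] -/
theorem map_neg_of_map_sub {A B : Type*} [AddCommGroup A] [AddCommGroup B] (T : A → B) (hT : ∀ a b, T (a - b) = T a - T b)
    (a : A) : T (-a) = -T a := by
  have h := hT 0 a
  rwa [zero_sub, map_zero_of_map_sub T hT, zero_sub] at h

/-! ## The three gauge rows of `exists_unique_exact_corrector_gauge` for `p x = max ‖x‖ (max (ℓ₁‖T₁ x‖) (ℓ₂‖T₂ x‖))` -/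

/-- ★ Row `hp_norm`: the instance norm is dominated by the gauge, `‖x‖ ≤ p x`.  [cite: Balaban1985Variational, Prop. 7 p.299] -/
theorem gauge_norm_le (p : X → ℝ) (T₁ : X → E₁) (T₂ : X → E₂) (ℓ₁ ℓ₂ : ℝ)
    (hp : ∀ x, p x = max ‖x‖ (max (ℓ₁ * ‖T₁ x‖) (ℓ₂ * ‖T₂ x‖))) (x : X) : ‖x‖ ≤ p x := by
  rw [hp]
  exact le_max_left _ _

/-- ★ The gauge is nonnegative.  [cite: Balaban1985Variational, Prop. 7 p.299] -/
theorem gauge_nonneg (p : X → ℝ) (T₁ : X → E₁) (T₂ : X → E₂) (ℓ₁ ℓ₂ : ℝ)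
    (hp : ∀ x, p x = max ‖x‖ (max (ℓ₁ * ‖T₁ x‖) (ℓ₂ * ‖T₂ x‖))) (x : X) : 0 ≤ p x :=
  (norm_nonneg x).trans (gauge_norm_le p T₁ T₂ ℓ₁ ℓ₂ hp x)

/-- ★ The gauge vanishes at `0` (additive `Tᵢ`).  [cite: Balaban1985Variational, Prop. 7 p.299] -/
theorem gauge_zero (p : X → ℝ) (T₁ : X → E₁) (T₂ : X → E₂) (ℓ₁ ℓ₂ : ℝ)
    (hp : ∀ x, p x = max ‖x‖ (max (ℓ₁ * ‖T₁ x‖) (ℓ₂ * ‖T₂ x‖)))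
    (hT₁ : ∀ a b, T₁ (a - b) = T₁ a - T₁ b) (hT₂ : ∀ a b, T₂ (a - b) = T₂ a - T₂ b) : p 0 = 0 := by
  rw [hp, map_zero_of_map_sub T₁ hT₁, map_zero_of_map_sub T₂ hT₂, norm_zero, norm_zero, norm_zero, mul_zero, mul_zero,
    max_self, max_self]

/-- ★ Evenness `p (−x) = p x` (additive `Tᵢ`).  [cite: Balaban1985Variational, Prop. 7 p.299] -/
theorem gauge_neg (p : X → ℝ) (T₁ : X → E₁) (T₂ : X → E₂) (ℓ₁ ℓ₂ : ℝ)
    (hp : ∀ x, p x = max ‖x‖ (max (ℓ₁ * ‖T₁ x‖) (ℓ₂ * ‖T₂ x‖)))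
    (hT₁ : ∀ a b, T₁ (a - b) = T₁ a - T₁ b) (hT₂ : ∀ a b, T₂ (a - b) = T₂ a - T₂ b) (x : X) : p (-x) = p x := by
  rw [hp, hp x, map_neg_of_map_sub T₁ hT₁, map_neg_of_map_sub T₂ hT₂, norm_neg, norm_neg, norm_neg]

/-- ★★ Row `hp_tri`: the three-point triangle inequality `p (a − c) ≤ p (a − b) + p (b − c)` (additive `Tᵢ`, `0 ≤ ℓᵢ`).
[cite: Balaban1985Variational, Prop. 7 p.299] -/
theorem gauge_tri (p : X → ℝ) (T₁ : X → E₁) (T₂ : X → E₂) {ℓ₁ ℓ₂ : ℝ} (hℓ₁ : 0 ≤ ℓ₁) (hℓ₂ : 0 ≤ ℓ₂)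
    (hp : ∀ x, p x = max ‖x‖ (max (ℓ₁ * ‖T₁ x‖) (ℓ₂ * ‖T₂ x‖)))
    (hT₁ : ∀ a b, T₁ (a - b) = T₁ a - T₁ b) (hT₂ : ∀ a b, T₂ (a - b) = T₂ a - T₂ b) (a b c : X) :
    p (a - c) ≤ p (a - b) + p (b - c) := by
  -- the three components of `p (a - b)` and `p (b - c)` are each dominated by the respective gauge
  have hab0 : ‖a - b‖ ≤ p (a - b) := gauge_norm_le p T₁ T₂ ℓ₁ ℓ₂ hp _
  have hbc0 : ‖b - c‖ ≤ p (b - c) := gauge_norm_le p T₁ T₂ ℓ₁ ℓ₂ hp _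
  have hab1 : ℓ₁ * ‖T₁ (a - b)‖ ≤ p (a - b) := by rw [hp]; exact le_trans (le_max_left _ _) (le_max_right _ _)
  have hbc1 : ℓ₁ * ‖T₁ (b - c)‖ ≤ p (b - c) := by rw [hp]; exact le_trans (le_max_left _ _) (le_max_right _ _)
  have hab2 : ℓ₂ * ‖T₂ (a - b)‖ ≤ p (a - b) := by rw [hp]; exact le_trans (le_max_right _ _) (le_max_right _ _)
  have hbc2 : ℓ₂ * ‖T₂ (b - c)‖ ≤ p (b - c) := by rw [hp]; exact le_trans (le_max_right _ _) (le_max_right _ _)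
  -- split `a - c = (a - b) + (b - c)` in each component
  have e0 : a - c = (a - b) + (b - c) := by abel
  have e1 : T₁ (a - c) = T₁ (a - b) + T₁ (b - c) := by rw [e0, map_add_of_map_sub T₁ hT₁]
  have e2 : T₂ (a - c) = T₂ (a - b) + T₂ (b - c) := by rw [e0, map_add_of_map_sub T₂ hT₂]
  rw [hp (a - c)]
  refine max_le ?_ (max_le ?_ ?_)
  · calc ‖a - c‖ = ‖(a - b) + (b - c)‖ := by rw [← e0]
      _ ≤ ‖a - b‖ + ‖b - c‖ := norm_add_le _ _
      _ ≤ p (a - b) + p (b - c) := add_le_add hab0 hbc0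
  · calc ℓ₁ * ‖T₁ (a - c)‖ = ℓ₁ * ‖T₁ (a - b) + T₁ (b - c)‖ := by rw [e1]
      _ ≤ ℓ₁ * (‖T₁ (a - b)‖ + ‖T₁ (b - c)‖) := by gcongr; exact norm_add_le _ _
      _ = ℓ₁ * ‖T₁ (a - b)‖ + ℓ₁ * ‖T₁ (b - c)‖ := by ring
      _ ≤ p (a - b) + p (b - c) := add_le_add hab1 hbc1
  · calc ℓ₂ * ‖T₂ (a - c)‖ = ℓ₂ * ‖T₂ (a - b) + T₂ (b - c)‖ := by rw [e2]
      _ ≤ ℓ₂ * (‖T₂ (a - b)‖ + ‖T₂ (b - c)‖) := by gcongr; exact norm_add_le _ _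
      _ = ℓ₂ * ‖T₂ (a - b)‖ + ℓ₂ * ‖T₂ (b - c)‖ := by ring
      _ ≤ p (a - b) + p (b - c) := add_le_add hab2 hbc2

/-- Subadditivity `p (a + b) ≤ p a + p b` (from `gauge_tri`).  [cite: Balaban1985Variational, Prop. 7 p.299] -/
theorem gauge_add_le (p : X → ℝ) (T₁ : X → E₁) (T₂ : X → E₂) {ℓ₁ ℓ₂ : ℝ} (hℓ₁ : 0 ≤ ℓ₁) (hℓ₂ : 0 ≤ ℓ₂)
    (hp : ∀ x, p x = max ‖x‖ (max (ℓ₁ * ‖T₁ x‖) (ℓ₂ * ‖T₂ x‖)))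
    (hT₁ : ∀ a b, T₁ (a - b) = T₁ a - T₁ b) (hT₂ : ∀ a b, T₂ (a - b) = T₂ a - T₂ b) (a b : X) :
    p (a + b) ≤ p a + p b := by
  have h := gauge_tri p T₁ T₂ hℓ₁ hℓ₂ hp hT₁ hT₂ (a + b) b 0
  simp only [sub_zero, add_sub_cancel_right] at h
  exact h

/-- ★★ Row `hp_le`: the gauge is dominated by a multiple of the instance norm, `p x ≤ max 1 (max (ℓ₁a₁) (ℓ₂a₂)) * ‖x‖`, from the crude operator bounds
`‖Tᵢ x‖ ≤ aᵢ‖x‖` and `0 ≤ ℓᵢ`.  [cite: Balaban1985Variational, Prop. 7 p.299] -/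
theorem gauge_le_mul_norm (p : X → ℝ) (T₁ : X → E₁) (T₂ : X → E₂) {ℓ₁ ℓ₂ a₁ a₂ : ℝ} (hℓ₁ : 0 ≤ ℓ₁) (hℓ₂ : 0 ≤ ℓ₂)
    (hp : ∀ x, p x = max ‖x‖ (max (ℓ₁ * ‖T₁ x‖) (ℓ₂ * ‖T₂ x‖)))
    (hb₁ : ∀ x, ‖T₁ x‖ ≤ a₁ * ‖x‖) (hb₂ : ∀ x, ‖T₂ x‖ ≤ a₂ * ‖x‖) (x : X) :
    p x ≤ max 1 (max (ℓ₁ * a₁) (ℓ₂ * a₂)) * ‖x‖ := by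
  have hx : 0 ≤ ‖x‖ := norm_nonneg x
  rw [hp]
  refine max_le ?_ (max_le ?_ ?_)
  · calc ‖x‖ = 1 * ‖x‖ := (one_mul _).symm
      _ ≤ max 1 (max (ℓ₁ * a₁) (ℓ₂ * a₂)) * ‖x‖ := by gcongr; exact le_max_left _ _
  · calc ℓ₁ * ‖T₁ x‖ ≤ ℓ₁ * (a₁ * ‖x‖) := by gcongr; exact hb₁ x
      _ = (ℓ₁ * a₁) * ‖x‖ := by ring
      _ ≤ max 1 (max (ℓ₁ * a₁) (ℓ₂ * a₂)) * ‖x‖ := by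
          gcongr; exact le_trans (le_max_left _ _) (le_max_right _ _)
  · calc ℓ₂ * ‖T₂ x‖ ≤ ℓ₂ * (a₂ * ‖x‖) := by gcongr; exact hb₂ x
      _ = (ℓ₂ * a₂) * ‖x‖ := by ring
      _ ≤ max 1 (max (ℓ₁ * a₁) (ℓ₂ * a₂)) * ‖x‖ := by
          gcongr; exact le_trans (le_max_right _ _) (le_max_right _ _)

end Summit.QuantumFields.YangMills.Theorems.Prop7GaugeRowsMaxSup
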